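import Summits.AtomisticToContinuum.Crystallization.Theorems.TwoCentreKissingKernelRobustTangencyBoundPentagonIsolated
import HarnessLib

/-!
# `RobustTangencyBound` — reusable blocks of the geometric translation (step (III) factory)

Route `TwoCentreKissingKernel`, item `stmt-AtomisticToContinuum-12082`, blueprint (III) §11.  The generated translations
(`…P34Isolated`, `…P123Isolated`, and the hexagon / joint configurations to come) repeat two blocks
per constrained vertex and per cluster corner; this file proves them once:

* `cornerZ X c y` — the unit complex number `cos θ + i sin θ` of the corner of facet `c` at `y`;
* `vertex_block` — at a vertex `y` whose cluster facets are the list `fl` (no duplicates, all tight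
  at `y`) and whose other facets are soft triangles: the regular facets `R` are at most five, their
  corners lie in the regular windows, and `Π_{c ∈ fl} cornerZ c y · Π_{c' ∈ R} cornerZ c' y = 1`;
* `corner_block` — a cluster corner in forward form: for a facet with vertices `{y, u, w}`,
  `cos (cornerAngle X c y) = N/√D²`, `sin = √(1 − cos²)` with `N = ⟪u,w⟫ − ⟪y,u⟫⟪y,w⟫`,
  `D² = (1 − ⟪y,u⟫²)(1 − ⟪y,w⟫²)` (`cornerAngle_triangle` + `corner_forward`);
* `facet_ne_of_mem_of_not_mem`, `zOf_cornerR_of_forward` (evaluation of a forward corner term at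
  any point carrying the three inner products) — appended for generator v2.
-/

noncomputable section

namespace Summit.AtomisticToContinuum.Crystallization.Theorems

open Real RealInnerProductSpace InnerProductGeometry Literature.Geometry.DiscreteGeometry
  Literature.Analysis.ValidatedNumerics Finset

/-- The unit complex number of the corner of facet `c` at the vertex `y`. -/
def cornerZ (X : Finset (EuclideanSpace ℝ (Fin 3))) (c y : EuclideanSpace ℝ (Fin 3)) : ℂ :=
  (Real.cos (cornerAngle X c y) : ℂ) + (Real.sin (cornerAngle X c y) : ℂ) * Complex.I

/-- **The vertex block.** At a vertex `y` of a normalised soft shell, let `fl` be a duplicate-free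
list of facets tight at `y` (the cluster facets through `y`) such that every OTHER facet through
`y` is a soft triangle at `y`.  Then the remaining facets `R` through `y` number at most five, their
corners lie in the regular windows, and the vertex condition reads
`(fl.map (cornerZ X · y)).prod * (R.toList.map (cornerZ X · y)).prod = 1`. -/
theorem vertex_block {X : Finset (EuclideanSpace ℝ (Fin 3))} (hX1 : ∀ z ∈ X, ‖z‖ = 1)
    (h0 : (0 : EuclideanSpace ℝ (Fin 3)) ∈ interior (convexHull ℝ (X : Set (EuclideanSpace ℝ (Fin 3)))))
    {η : ℝ} (hη0 : 0 ≤ η) (hη : η ≤ 1 / 1000)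
    (hsep : ∀ p ∈ X, ∀ q ∈ X, p ≠ q → ⟪p, q⟫ ≤ 1 / 2 + 2 * η)
    {y : EuclideanSpace ℝ (Fin 3)} (hy : y ∈ X) (fl : List (EuclideanSpace ℝ (Fin 3))) (hnd : fl.Nodup)
    (hfl : ∀ c ∈ fl, c ∈ facetNormals X ∧ ⟪c, y⟫ = 1)
    (hreg : ∀ c' ∈ facetNormals X, ⟪c', y⟫ = 1 → c' ∉ fl → SoftTriangleAt η X c' y) :
    ∃ R : Finset (EuclideanSpace ℝ (Fin 3)), R.toList.length ≤ 5 ∧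
      (∀ c' ∈ R.toList, InIvl ((3252 : ℚ) / 10000, (3415 : ℚ) / 10000) (Real.cos (cornerAngle X c' y)) ∧
        InIvl ((9398 : ℚ) / 10000, (9457 : ℚ) / 10000) (Real.sin (cornerAngle X c' y))) ∧
      (fl.map fun c => cornerZ X c y).prod * (R.toList.map fun c' => cornerZ X c' y).prod = 1 := by
  classical
  set S := (facetNormals X).filter (fun c' => ⟪c', y⟫ = 1) with hS
  set R := S \ fl.toFinset with hR
  have hflS : fl.toFinset ⊆ S := by
    intro c hc
    rw [List.mem_toFinset] at hc
    exact mem_filter.2 (hfl c hc)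
  have hRsub : R ⊆ S := sdiff_subset
  have hRreg : ∀ c' ∈ R, SoftTriangleAt η X c' y := by
    intro c' hc'
    obtain ⟨hS', hnot⟩ := mem_sdiff.1 hc'
    obtain ⟨hF, hcy⟩ := mem_filter.1 hS'
    exact hreg c' hF hcy (fun h => hnot (List.mem_toFinset.2 h))
  refine ⟨R, ?_, ?_, ?_⟩
  · rw [length_toList]; exact card_le_five_of_softTriangles hX1 h0 hη0 hη hsep hy hRsub hRreg
  · intro c' hc'
    exact (window_of_softTriangleAt hX1 h0 hη0 hη hsep (mem_filter.1 (hRsub (mem_toList.1 hc'))).1 hy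
      (hRreg c' (mem_toList.1 hc'))).1
  · have h := vertex_product_eq_one hX1 h0 hy
    rw [← hS] at h
    have hsplit : S = fl.toFinset ∪ R := by
      rw [hR, union_sdiff_of_subset hflS]
    have hdisj : Disjoint fl.toFinset R := disjoint_sdiff
    rw [hsplit, prod_union hdisj, List.prod_toFinset _ hnd] at h
    rw [prod_map_toList]
    exact h

/-- **The corner block**: a cluster corner in forward form.  For a facet `c` with vertices
`{y, u, w}` (distinct), `cos (cornerAngle X c y) = N (√D²)⁻¹` and
`sin (cornerAngle X c y) = √(1 − (N (√D²)⁻¹)²)` with `N = ⟪u,w⟫ − ⟪y,u⟫⟪y,w⟫`,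
`D² = (1 − ⟪y,u⟫²)(1 − ⟪y,w⟫²)`. -/
theorem corner_block {X : Finset (EuclideanSpace ℝ (Fin 3))} (hX1 : ∀ z ∈ X, ‖z‖ = 1)
    (h0 : (0 : EuclideanSpace ℝ (Fin 3)) ∈ interior (convexHull ℝ (X : Set (EuclideanSpace ℝ (Fin 3)))))
    {c y u w : EuclideanSpace ℝ (Fin 3)} (hcF : c ∈ facetNormals X) (hT : tightSet X c = {y, u, w})
    (hyu : y ≠ u) (hyw : y ≠ w) (huw : u ≠ w) (qyu : ⟪y, u⟫ ^ 2 < 1) (qyw : ⟪y, w⟫ ^ 2 < 1) :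
    Real.cos (cornerAngle X c y) =
      (⟪u, w⟫ - ⟪y, u⟫ * ⟪y, w⟫) * (Real.sqrt ((1 - ⟪y, u⟫ ^ 2) * (1 - ⟪y, w⟫ ^ 2)))⁻¹ ∧
    Real.sin (cornerAngle X c y) =
      Real.sqrt (1 - ((⟪u, w⟫ - ⟪y, u⟫ * ⟪y, w⟫) *
        (Real.sqrt ((1 - ⟪y, u⟫ ^ 2) * (1 - ⟪y, w⟫ ^ 2)))⁻¹) ^ 2) := by
  have hyX : y ∈ X := (mem_tightSet.1 (by rw [hT]; simp : y ∈ tightSet X c)).1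
  have huX : u ∈ X := (mem_tightSet.1 (by rw [hT]; simp : u ∈ tightSet X c)).1
  have hwX : w ∈ X := (mem_tightSet.1 (by rw [hT]; simp : w ∈ tightSet X c)).1
  rw [cornerAngle_triangle hX1 h0 hcF hT hyu hyw huw]
  exact corner_forward (hX1 _ hyX) (hX1 _ huX) (hX1 _ hwX) qyu qyw

/-- Two facets differ as soon as a vertex of the first is not a vertex of the second. -/
theorem facet_ne_of_mem_of_not_mem {X : Finset (EuclideanSpace ℝ (Fin 3))} {c c' x : EuclideanSpace ℝ (Fin 3)}
    (hx : x ∈ tightSet X c) (hx' : x ∉ tightSet X c') : c ≠ c' := fun h => hx' (h ▸ hx)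

/-- **Evaluation of a forward-form corner at a point**: if the point `q` carries the three inner
products `a = ⟪y,u⟫`, `b = ⟪y,w⟫`, `d = ⟪u,w⟫` at positions `i, j, k` and `θ` has the forward
cosine / sine, then `zOf q (cornerR (var k − var i · var j) ((1 − var i²)(1 − var j²)))` is
`cos θ + i sin θ`. -/
theorem zOf_cornerR_of_forward (q : ℕ → ℝ) {i j k : ℕ} {a b d θ : ℝ} (hi : q i = a) (hj : q j = b)
    (hk : q k = d)
    (hC : Real.cos θ = (d - a * b) * (Real.sqrt ((1 - a ^ 2) * (1 - b ^ 2)))⁻¹)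
    (hS : Real.sin θ = Real.sqrt (1 - ((d - a * b) * (Real.sqrt ((1 - a ^ 2) * (1 - b ^ 2)))⁻¹) ^ 2)) :
    zOf q (cornerR (.sub (.var k) (.mul (.var i) (.var j)))
      (.mul (.sub (.const 1) (.sq (.var i))) (.sub (.const 1) (.sq (.var j))))) =
      (Real.cos θ : ℂ) + (Real.sin θ : ℂ) * Complex.I := by
  rw [zOf_cornerR, hC, hS]
  simp only [RExpr.eval, hi, hj, hk]
  push_cast; ring_nf

/-- **The vertex block with the facet count.** As `vertex_block`, and in addition the number of
regular facets is the number of facets through `y` minus the number of cluster facets: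
`R.toList.length + fl.length = #{c ∈ facetNormals X | ⟪c, y⟫ = 1}` — so a driver that knows the
facet count at `y` knows `R.toList.length`. -/
theorem vertex_block_count {X : Finset (EuclideanSpace ℝ (Fin 3))} (hX1 : ∀ z ∈ X, ‖z‖ = 1)
    (h0 : (0 : EuclideanSpace ℝ (Fin 3)) ∈ interior (convexHull ℝ (X : Set (EuclideanSpace ℝ (Fin 3)))))
    {η : ℝ} (hη0 : 0 ≤ η) (hη : η ≤ 1 / 1000)
    (hsep : ∀ p ∈ X, ∀ q ∈ X, p ≠ q → ⟪p, q⟫ ≤ 1 / 2 + 2 * η)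
    {y : EuclideanSpace ℝ (Fin 3)} (hy : y ∈ X) (fl : List (EuclideanSpace ℝ (Fin 3))) (hnd : fl.Nodup)
    (hfl : ∀ c ∈ fl, c ∈ facetNormals X ∧ ⟪c, y⟫ = 1)
    (hreg : ∀ c' ∈ facetNormals X, ⟪c', y⟫ = 1 → c' ∉ fl → SoftTriangleAt η X c' y) :
    ∃ R : Finset (EuclideanSpace ℝ (Fin 3)), R.toList.length ≤ 5 ∧
      (∀ c' ∈ R.toList, InIvl ((3252 : ℚ) / 10000, (3415 : ℚ) / 10000) (Real.cos (cornerAngle X c' y)) ∧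
        InIvl ((9398 : ℚ) / 10000, (9457 : ℚ) / 10000) (Real.sin (cornerAngle X c' y))) ∧
      (fl.map fun c => cornerZ X c y).prod * (R.toList.map fun c' => cornerZ X c' y).prod = 1 ∧
      R.toList.length + fl.length = ((facetNormals X).filter fun c' => ⟪c', y⟫ = 1).card := by
  classical
  set S := (facetNormals X).filter (fun c' => ⟪c', y⟫ = 1) with hS
  set R := S \ fl.toFinset with hR
  have hflS : fl.toFinset ⊆ S := by
    intro c hc
    rw [List.mem_toFinset] at hc
    exact mem_filter.2 (hfl c hc)
  have hRsub : R ⊆ S := sdiff_subset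
  have hRreg : ∀ c' ∈ R, SoftTriangleAt η X c' y := by
    intro c' hc'
    obtain ⟨hS', hnot⟩ := mem_sdiff.1 hc'
    obtain ⟨hF, hcy⟩ := mem_filter.1 hS'
    exact hreg c' hF hcy (fun h => hnot (List.mem_toFinset.2 h))
  refine ⟨R, ?_, ?_, ?_, ?_⟩
  · rw [length_toList]; exact card_le_five_of_softTriangles hX1 h0 hη0 hη hsep hy hRsub hRreg
  · intro c' hc'
    exact (window_of_softTriangleAt hX1 h0 hη0 hη hsep (mem_filter.1 (hRsub (mem_toList.1 hc'))).1 hy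
      (hRreg c' (mem_toList.1 hc'))).1
  · have h := vertex_product_eq_one hX1 h0 hy
    rw [← hS] at h
    have hsplit : S = fl.toFinset ∪ R := by
      rw [hR, union_sdiff_of_subset hflS]
    have hdisj : Disjoint fl.toFinset R := disjoint_sdiff
    rw [hsplit, prod_union hdisj, List.prod_toFinset _ hnd] at h
    rw [prod_map_toList]
    exact h
  · have hcard : (fl.toFinset).card = fl.length := List.toFinset_card_of_nodup hnd
    have h := card_sdiff_add_card_eq_card hflS
    rw [hcard] at h
    rw [length_toList, hR]
    exact h

end Summit.AtomisticToContinuum.Crystallization.Theorems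

end
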